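/- Copyright: the b2b-balaban cell (near-miss cell 7), T⁴-continuum fan-out; row NE7b CRUX team (2), seat
t4-ne7b-formalise-leaf-05 (gen 35) — IR-46-2's standing division «… leaf-05 toy-instantiates» applied to the OWNER's INTERFACE
REQUEST NE7b IR-52-1 «THE LATTICE-UNIT ROAD» item (d) (RULINGS R-OWNER-52-3 ∕ R-OWNER-53-1, `CLAIMS.log` l.35615 ∕ l.35706;
records (a) `HistoryRealiseCellsRunAssemblyWTVSDataLWL` and (b) `HistoryRealiseCellsRunAssemblyWTVSLWLP82` by the custodian leaf-03
g29, R-OWNER-53-2; OWNER W-ne7bp1-g53-3),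
part 16 of the sanity series.  Released under the licence of the surrounding project. -/
import Summits.QuantumFields.BalabanUV.T4Continuum.Support.HistoryRealiseCellsRunAssemblyWTVSSanityLWL
import Summits.QuantumFields.BalabanUV.T4Continuum.Support.HistoryRealiseCellsRunAssemblyWTVSLWLP82

/-!
# Sanity for the (α) assembly, part 16: THE LATTICE-UNIT TWIN `HistReadDataLWL` HAS A KERNEL INHABITANT — ALL ITS FIELDS, NO
DATUM HYPOTHESIS — AND THE LATTICE ROAD `toLP82L` RUNS ON IT BEYOND THE TWO WINDOWS (companion of
`HistoryRealiseCellsRunAssemblyWTVSDataLWL` ∕ `…AssemblyWTVSLWLP82`; lineage `t4-ne7b-formalise-leaf-05` gen 35)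

Summits-side support leaf of the T⁴-continuum cell (rung (B)+1 on a FINITE torus only; NOT infinite volume, NOT the
mass gap, NOT Clay; NOT a proof of NE7b — NOT PRINTED, NOT PROVED).  [decided toy] over part 15 (`lamVolL`, `Φ₅`, `C₄`,
`histReadDataLWL₄`), part 7 (`gW`, `isRj_toyData_gW`, `flow27_toyData`, `inInterval_toyData_gW`, `exists_pow_windows`), parts
1–3's toy facts and the custodian's (a)∕(b), ALL REUSED BY NAME; one `def` (the named inhabitant), theorems and `example`s;
nothing printed asserted, no `def … : Prop` fact, no cite-tagged hypothesis, zero `sorry`.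

§22 `one_le_lamVolL_toyData` (the lattice pin ≥ 1 on the toy datum's window couplings); **`histReadDataLWL_toyData (hS :
1 ≤ S) … : HistReadDataLWL (toyData F G) C₄ O₁ θv 1 1 n hn (gW F.L S) [] cΛ 1 Lr Φ β₀ 5 3 2 2 1 4 Isk Isk …`** (lattice
letter `M := 1 = O₁.M`) — part 15's
constructor with EVERY displayed input DISCHARGED (§5 of part 7, parts 1–3); `nonempty_histReadDataLWL_toyData`; the lattice
display read back: `log (Dd.Φf.Λ K t) = uvolL cΛ 1 1 g Rc K t` (`hΛL`, by the record) and `= (1·L^S)·uvol …` at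
`Rc := L^S` (`uvolL_eq_mul_uvol`).
§23 THE CUSTODIAN's (b) RUN BY NAME on it, for `S` beyond the rounding window `ℓ⋆ = ellStar C₄ O₁ F.L (O₁.d+3) 3 2 2 …` and the
LATTICE volume window `ℓᵥ82ᴸ = ellVolS82L C₄ 1 1 4 cΛ 1 F.L θv ((1+β₀)·F.L) (jvol82 1 ((1+β₀)·F.L))`:
**`nonempty_histReadDataLP_toyData_viaLWL82`** (`HistReadDataLWL.toLP82L` — the plug record AT THE LATTICE WEIGHT
`cvol82 1 (jvol82 1 ((1+β₀)·F.L^1)) ((1+β₀)·F.L^1)`), **`exists_histReadDataLP_toyData_viaLWL82`** (`∃ S`, unconditionally;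
the weight clause by `rfl` — a NEW weight term, not part 13's per-cube `cvol82 1 (jvol82 1 (1+β₀)) (1+β₀)`),
**`nonempty_countRoadWitnessT3bWTVSL_toyData_viaLWL82`** ((b) §2), `exists_…`; `example : ¬(B)` on `toyData`.

HONEST.  [decided toy] one-liners at TOY letters (c2), `liveCV = ∅` — on the toy the plug quantifies over NO live component
and `huV` over NO bad term (VACUOUS by design); the windows are paid by SMALLNESS of the window couplings `gW ≡ e^{−L^S∕2}`,
never by the record; this is the lattice-unit record's NON-VACUITY CERTIFICATE (R-OWNER-53-1 (3)), NOT a headline instance;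
nothing of Bałaban's read, asserted or contested; (B) FAILS on `toyData`; BY-NAME EFFECT ON THE WALL: NONE; NE7b NOT
PRINTED ∕ NOT PROVED; spine 0∕9.  HONEST DEPENDENCY (cell): continuum YM on T⁴ ⇐ BetaPertH ∧ nine spine estimates (0/9
proved); BetaPertH ⇐ (D1) ∧ (D4) ∧ CAP+tail; G-an2-4 gates asym, D1 and NE2/3/4.  Unchanged here.
-/

open Finset MeasureTheory
open Literature.MathematicalPhysics.QuantumFieldTheory.Balaban1983to89
open Literature.MathematicalPhysics.QuantumFieldTheory.Balaban1983to89.B16SProfile (DropCtl)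
open T4PersistenceDictionary T4PersistentHistoryCount T4BankedInduction T4PrintedShapeBanking
open T4WeightBudget T4GlobalDenominator T4LiveClassFibration T4LiveStructureGas T4LiveGasToTerms T4RecordPriceSeam
open T4PartnerMultiplicity T4IndicatorShell T4MatchingAssembly T4MatchingClosure T4MatchingClosureSocket T4Continuum
open T4StabilitySocket T4BranchingRecordsGas T4TaggedShapeBanking T4CanonicalMenus T4RenewalChains
open Summit.QuantumFields.BalabanUV.T4Continuum.HistoryFlow Summit.QuantumFields.BalabanUV.T4Continuum.HistoryGen
open Summit.QuantumFields.BalabanUV.T4Continuum.HistoryAdmissible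
open Summit.QuantumFields.BalabanUV.T4Continuum.HistoryGenealogyExtraction
open Summit.QuantumFields.BalabanUV.T4Continuum.HistoryGenealogyRealise
open Summit.QuantumFields.BalabanUV.T4Continuum.HistoryGenealogyInstantiate
open Summit.QuantumFields.BalabanUV.T4Continuum.HistoryGenealogyPedigree
open Summit.QuantumFields.BalabanUV.T4Continuum.HistoryAssemblyPedigree Summit.QuantumFields.BalabanUV.T4Continuum.HistoryAssemblyTerms
open Summit.QuantumFields.BalabanUV.T4Continuum.HistoryAssemblyMult Summit.QuantumFields.BalabanUV.T4Continuum.HistoryAssemblyMultKey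
open Summit.QuantumFields.BalabanUV.T4Continuum.HistoryAssemblyRealiseRun Summit.QuantumFields.BalabanUV.T4Continuum.HistorySocketTH
open Summit.QuantumFields.BalabanUV.T4Continuum.HistoryRealiseDistinct
open Summit.QuantumFields.BalabanUV.T4Continuum.HistoryRealiseCellsRunApexT3bWTVS
open Summit.QuantumFields.BalabanUV.T4Continuum.HistoryRealiseCellsRunApexT3bWTVSL
open Summit.QuantumFields.BalabanUV.T4Continuum.B16HistoryIndexedRepr
open Summit.QuantumFields.BalabanUV.T4Continuum.B16HistoryIndexedTrunc
open Summit.QuantumFields.BalabanUV.T4Continuum.HistoryBankingLE Summit.QuantumFields.BalabanUV.T4Continuum.HistoryBankingVolumePlug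
open Summit.QuantumFields.BalabanUV.T4Continuum.HistoryConstants Summit.QuantumFields.BalabanUV.T4Continuum.HistoryBankingDiscountCharge
open Summit.QuantumFields.BalabanUV.T4Continuum.HistoryBankingCreditRead Summit.QuantumFields.BalabanUV.T4Continuum.HistoryBankingFibreRoom
open Summit.QuantumFields.BalabanUV.T4Continuum.HistoryPriceNodeSum Summit.QuantumFields.BalabanUV.T4Continuum.HistoryPriceKeys
open Summit.QuantumFields.BalabanUV.T4Continuum.HistoryRealiseCellsRunSupplyWTVS
open Summit.QuantumFields.BalabanUV.T4Continuum.HistoryRealiseCellsRunSupplyKeysWTVS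
open Summit.QuantumFields.BalabanUV.T4Continuum.HistoryRealiseCellsRunSupplyWTVSSanity
open Summit.QuantumFields.BalabanUV.T4Continuum.HistoryRealiseCellsRunSupplyKeysWTVSSanity
open Summit.QuantumFields.BalabanUV.T4Continuum.HistoryRealiseCellsRunAssemblyWTVSData
open Summit.QuantumFields.BalabanUV.T4Continuum.HistoryRealiseCellsRunAssemblyWTVS
open Summit.QuantumFields.BalabanUV.T4Continuum.HistoryRealiseCellsRunAssemblyWTVSDataL
open Summit.QuantumFields.BalabanUV.T4Continuum.HistoryRealiseCellsRunAssemblyWTVSDataLP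
open Summit.QuantumFields.BalabanUV.T4Continuum.HistoryRealiseCellsRunAssemblyWTVSDataLW
open Summit.QuantumFields.BalabanUV.T4Continuum.HistoryRealiseCellsRunAssemblyWTVSDataLWL
open Summit.QuantumFields.BalabanUV.T4Continuum.HistoryRealiseCellsRunAssemblyWTVSL
open Summit.QuantumFields.BalabanUV.T4Continuum.HistoryRealiseCellsRunAssemblyWTVSLW
open Literature.MathematicalPhysics.QuantumFieldTheory.Balaban1983to89.T4FiniteEpsInhabited
open Missing AveragingRT T4Continuum T4StabilitySocket T4MatchingClosure T4IndicatorShell T4LiveClassFibration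
open T4RenewalChains T4PersistenceDictionary T4BranchingRecordsGas T4PrintedShapeBanking T4TaggedShapeBanking
open Summit.QuantumFields.BalabanUV.T4Continuum.HistoryRealiseCellsRunApexWitness
open Summit.QuantumFields.BalabanUV.T4Continuum.HistoryRealiseCellsRunAssemblyWTVSLP
open Summit.QuantumFields.BalabanUV.T4Continuum.HistoryRealiseCellsRunAssemblyWTVSLWP82
open Summit.QuantumFields.BalabanUV.T4Continuum.HistoryRealiseCellsRunAssemblyWTVSLWLP82
open Summit.QuantumFields.BalabanUV.T4Continuum.HistoryBankingSharpShares (ell sBsharp)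
open Summit.QuantumFields.BalabanUV.T4Continuum.HistoryBankingRoundingUnrounded (sRunr ApFlat)
open Summit.QuantumFields.BalabanUV.T4Continuum.HistoryBankingRoundingSupply (ellStar)
open Summit.QuantumFields.BalabanUV.T4Continuum.HistoryBankingVolumeWindow (uvol lamVol jvol log_lamVol one_le_lamVol)
open Summit.QuantumFields.BalabanUV.T4Continuum.HistoryBankingVolumeWindowLattice (uvolL uvolL_nonneg uvolL_eq_mul_uvol)
open Summit.QuantumFields.BalabanUV.T4Continuum.HistoryBankingVolumeWindowShrunk82 (jvol82 ellVolS82L)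
open Summit.QuantumFields.BalabanUV.T4Continuum.HistoryBankingShrunkLedger82 (cvol82)

namespace Summit.QuantumFields.BalabanUV.T4Continuum.HistoryRealiseCellsRunAssemblyWTVSSanity

noncomputable section

open B16HistoryIndexedRepr.Sanity B16HistoryIndexedRepr.SanityInput HistoryConstants.Sanity HistoryBankingCreditRead.Sanity

set_option synthInstance.maxSize 1024

section ToyData

variable (F : T4Family) (G : Type) [GaugeGroup G] [MeasurableSpace G] [HaarData G] [RegularGaugeGroup G]

/-! ## §22 The lattice-unit twin record on the toy datum — no datum hypothesis -/

/-- **THE LATTICE PIN IS AT LEAST ONE ON THE TOY DATUM** for every `cΛ ≥ 0`, `M ≥ 0` and any size letter `R`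
(`ℓ ≡ L^S ≥ 1`). [decided toy] -/
theorem one_le_lamVolL_toyData {cΛ M : ℝ} (hcΛ : 0 ≤ cΛ) (hM : 0 ≤ M) (S K t : ℕ) (R : ℕ → ℕ) :
    1 ≤ lamVolL cΛ M 1 ((toyData F G).C ⟨K, F.m, gW F.L S K⟩).flow.g R K t := by
  refine one_le_lamVolL hcΛ hM (fun j _ => ?_) t
  show 1 ≤ Real.log ((((toyData F G).C ⟨K, F.m, gW F.L S K⟩).flow.g j) ^ 2)⁻¹
  rw [toy_flow_g, log_gW_inv_sq]
  exact_mod_cast Nat.one_le_pow S F.L (lt_of_lt_of_le (by norm_num) (two_le_L F))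

/-- **THE NAMED INHABITANT OF THE LATTICE-UNIT TWIN**: `HistReadDataLWL` on the toy datum × the no-region reading of size
`L^S`, at the window couplings `e^{−L^S∕2}` (`1 ≤ S`), empty string, exponent `1`, toy constants `C₄`∕`O₁`, lattice letter
`M := 1` (`= O₁.M`, R-OWNER-53-2 (2)(iv)), census letters
`(p₁, η, η′, κ, κ₂, κᵥ) = (5, 3, 2, 2, 1, 4)` (the LATTICE identities, `identities_C₄`), for every `0 < θᵥ`, `0 ≤ cΛ`,
`0 ≤ Lr`, `0 ≤ Φ`, `0 ≤ β₀` — part 15's `histReadDataLWL₄` with every displayed input DISCHARGED by part 7 §5 and part 3.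
[decided toy] -/
def histReadDataLWL_toyData {S : ℕ} (hS : 1 ≤ S) {θv : ℝ} (hθv : 0 < θv) {cΛ Lr Φ : ℝ} (hcΛ : 0 ≤ cΛ) (hLr : 0 ≤ Lr)
    (hΦ : 0 ≤ Φ) {β₀ : ℝ} (hβ₀ : 0 ≤ β₀) (n : ℕ) (hn : 0 < n) :
    HistReadDataLWL (toyData F G) C₄ O₁ θv 1 1 n hn (gW F.L S) ([] : List (ULoop F)) cΛ 1 Lr Φ β₀ 5 3 2 2 1 4 Isk Isk
      (fun _ => Unit) μ₀ (fun _ => GoodClass.top Unit) (fun _ => Unit) μ₀ (fun _ => GoodClass.top Unit) :=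
  histReadDataLWL₄ (toyData F G) (avgMeasurable_toyData F G) (C := C₄) (O := O₁) le_rfl (by norm_num [C₄])
    (by norm_num [C₄]) (by norm_num [C₄]) (by norm_num [C₄]) (by norm_num [O₁]) (by norm_num [O₁]) (by norm_num [O₁])
    (by norm_num [O₁]) hθv 1 n hn (gW F.L S) [] (two_le_L_pow F hS) hcΛ zero_le_one hLr hΦ hβ₀ identities_C₄.1
    identities_C₄.2.1
    identities_C₄.2.2.1 identities_C₄.2.2.2.1 identities_C₄.2.2.2.2.1 identities_C₄.2.2.2.2.2.1 (by norm_num) (by norm_num)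
    (by norm_num) le_rfl (by norm_num) (ZD_toyData_le F G (gW F.L S)) (fun K s _ => isRj_toyData_gW F G S K s)
    (fun K t => one_le_lamVolL_toyData F G hcΛ zero_le_one S K t _) (fun K => flow27_toyData F G hβ₀ S K) (c₀ := 1) (n₁ := 0) one_pos
    (fun K => (smallFieldMass_toy F G K _).symm.le) (fun K => (smallFieldMass_toy F G (K + 1) _).symm.le)
    (fun K => by simp) (fun K => by simp) (shell_toyR _)
    (budget_toyR (fun K t _ => ZD_pos (toyData F G) (avgMeasurable_toyData F G) (gW F.L S) _ K t) _
      (ZD_toyData_succ F G (gW F.L S)) _)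
    summable_zero summable_zero summable_zero summable_zero

/-- **`HistReadDataLWL` IS INHABITED — ALL ITS FIELDS, NO DATUM HYPOTHESIS** — on the toy datum (every `1 ≤ S`, `0 < θᵥ`,
`0 ≤ cΛ`, `0 ≤ Lr`, `0 ≤ Φ`, `0 ≤ β₀`): the three replaced rows `hΛL`∕`hexpFL`∕`hexpVL` and the inserted `hdq` are
jointly satisfiable with the 117 kept ones (R-OWNER-53-1 (3)). [decided toy] -/
theorem nonempty_histReadDataLWL_toyData {S : ℕ} (hS : 1 ≤ S) {θv : ℝ} (hθv : 0 < θv) {cΛ Lr Φ : ℝ} (hcΛ : 0 ≤ cΛ)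
    (hLr : 0 ≤ Lr) (hΦ : 0 ≤ Φ) {β₀ : ℝ} (hβ₀ : 0 ≤ β₀) (n : ℕ) (hn : 0 < n) :
    Nonempty (HistReadDataLWL (toyData F G) C₄ O₁ θv 1 1 n hn (gW F.L S) ([] : List (ULoop F)) cΛ 1 Lr Φ β₀ 5 3 2 2 1 4
      Isk Isk (fun _ => Unit) μ₀ (fun _ => GoodClass.top Unit) (fun _ => Unit) μ₀ (fun _ => GoodClass.top Unit)) :=
  ⟨histReadDataLWL_toyData F G hS hθv hcΛ hLr hΦ hβ₀ n hn⟩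

/-- **THE LATTICE DISPLAY READ BACK ON THE TOY**: `log (Φf.Λ K t) = uvolL cΛ 1 1 g (L^S) K t` — the record's own `hΛL`
(the reading `ℛ₄ L (L^S)` has constant size `L^S`). [decided toy] -/
theorem log_Λ_histReadDataLWL_toyData {S : ℕ} (hS : 1 ≤ S) {θv : ℝ} (hθv : 0 < θv) {cΛ Lr Φ : ℝ} (hcΛ : 0 ≤ cΛ)
    (hLr : 0 ≤ Lr) (hΦ : 0 ≤ Φ) {β₀ : ℝ} (hβ₀ : 0 ≤ β₀) (n : ℕ) (hn : 0 < n) (K t : ℕ) :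
    Real.log ((histReadDataLWL_toyData F G hS hθv hcΛ hLr hΦ hβ₀ n hn).Φf.Λ K t) =
      uvolL cΛ 1 1 ((toyData F G).C ⟨K, F.m, gW F.L S K⟩).flow.g (fun _ => F.L ^ S) K t :=
  (histReadDataLWL_toyData F G hS hθv hcΛ hLr hΦ hβ₀ n hn).hΛL K t

/-- … and in the TWO CURRENCIES: the toy's lattice letter is `(1·L^S)^1` times its per-cube letter (leaf-06's
`uvolL_eq_mul_uvol`; G-M5-2's factor ON THE TOY). [decided toy] -/
theorem log_Λ_histReadDataLWL_toyData_eq_mul {S : ℕ} (hS : 1 ≤ S) {θv : ℝ} (hθv : 0 < θv) {cΛ Lr Φ : ℝ} (hcΛ : 0 ≤ cΛ)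
    (hLr : 0 ≤ Lr) (hΦ : 0 ≤ Φ) {β₀ : ℝ} (hβ₀ : 0 ≤ β₀) (n : ℕ) (hn : 0 < n) (K t : ℕ) :
    Real.log ((histReadDataLWL_toyData F G hS hθv hcΛ hLr hΦ hβ₀ n hn).Φf.Λ K t) =
      (1 * ((F.L ^ S : ℕ) : ℝ)) ^ 1 * uvol cΛ ((toyData F G).C ⟨K, F.m, gW F.L S K⟩).flow.g K t := by
  rw [log_Λ_histReadDataLWL_toyData, uvolL_eq_mul_uvol]

/-! ## §23 The OWNER's lattice road (b) on it: the plug record and the guarded witness, beyond the two windows -/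

/-- **(b) §1 `HistReadDataLWL.toLP82L` RUN BY NAME ON THE TOY**: for `S` beyond the rounding window `ℓ⋆` and the LATTICE
volume window `ℓᵥ82ᴸ`, the plug record `HistReadDataLP` on the toy datum AT THE LATTICE WEIGHT
`cvol82 1 (jvol82 1 ((1+β₀)·L^1)) ((1+β₀)·L^1)` — the volume calibrations DERIVED from the coupling interval by leaf-06's
lattice fillers inside (b), not displayed; the plug over NO live component, `huV` over NO bad term (VACUOUS on the toy
reading, by design). [decided toy] -/
theorem nonempty_histReadDataLP_toyData_viaLWL82 {S : ℕ} (hS : 1 ≤ S) {θv : ℝ} (hθv : 0 < θv) {cΛ Lr Φ : ℝ}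
    (hcΛ : 0 ≤ cΛ) (hLr : 0 ≤ Lr) (hΦ : 0 ≤ Φ) {β₀ : ℝ} (hβ₀ : 0 ≤ β₀) (n : ℕ) (hn : 0 < n)
    (hr : ellStar C₄ O₁ F.L (O₁.d + 3) 3 2 2 (ApFlat O₁.γ₀ O₁.A₁ O₁.M Lr O₁.d) Φ ≤ (F.L : ℝ) ^ S)
    (hv : ellVolS82L C₄ 1 1 4 cΛ 1 F.L θv ((1 + β₀) * F.L ^ 1) (jvol82 1 ((1 + β₀) * F.L ^ 1)) ≤ (F.L : ℝ) ^ S) :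
    Nonempty (HistReadDataLP (toyData F G) C₄ O₁ θv 1 1 n hn (gW F.L S) ([] : List (ULoop F)) Isk Isk (fun _ => Unit) μ₀
      (fun _ => GoodClass.top Unit) (fun _ => Unit) μ₀ (fun _ => GoodClass.top Unit)) :=
  ⟨(histReadDataLWL_toyData F G hS hθv hcΛ hLr hΦ hβ₀ n hn).toLP82L (inInterval_toyData_gW F G hr)
    (inInterval_toyData_gW F G hv)⟩

/-- **UNCONDITIONALLY: SOME WINDOW RUN OF THE TOY DATUM CARRIES THE PLUG RECORD AT THE LATTICE WEIGHT** (take `S` beyond both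
windows, `exists_pow_windows`; the weight read back by `rfl`). [decided toy] -/
theorem exists_histReadDataLP_toyData_viaLWL82 {θv : ℝ} (hθv : 0 < θv) {cΛ Lr Φ : ℝ} (hcΛ : 0 ≤ cΛ) (hLr : 0 ≤ Lr)
    (hΦ : 0 ≤ Φ) {β₀ : ℝ} (hβ₀ : 0 ≤ β₀) (n : ℕ) (hn : 0 < n) :
    ∃ S : ℕ, ∃ Dd : HistReadDataLP (toyData F G) C₄ O₁ θv 1 1 n hn (gW F.L S) ([] : List (ULoop F)) Isk Isk (fun _ => Unit)
      μ₀ (fun _ => GoodClass.top Unit) (fun _ => Unit) μ₀ (fun _ => GoodClass.top Unit),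
      Dd.wV = fun _ => cvol82 1 (jvol82 1 ((1 + β₀) * F.L ^ 1)) ((1 + β₀) * F.L ^ 1) := by
  obtain ⟨S, hS, hr, hv⟩ := exists_pow_windows F
    (ellStar C₄ O₁ F.L (O₁.d + 3) 3 2 2 (ApFlat O₁.γ₀ O₁.A₁ O₁.M Lr O₁.d) Φ)
    (ellVolS82L C₄ 1 1 4 cΛ 1 F.L θv ((1 + β₀) * F.L ^ 1) (jvol82 1 ((1 + β₀) * F.L ^ 1)))
  exact ⟨S, (histReadDataLWL_toyData F G hS hθv hcΛ hLr hΦ hβ₀ n hn).toLP82L (inInterval_toyData_gW F G hr)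
    (inInterval_toyData_gW F G hv), rfl⟩

/-- **(b) §2 RUN BY NAME ON THE TOY**: the GUARDED witness `CountRoadWitnessT3bWTVSL` on the toy datum at the window couplings,
THROUGH THE LATTICE ROAD (`nonempty_countRoadWitnessT3bWTVSL_of_histReadingLWL82`), for `S` beyond both windows. [decided toy] -/
theorem nonempty_countRoadWitnessT3bWTVSL_toyData_viaLWL82 {S : ℕ} (hS : 1 ≤ S) {θv : ℝ} (hθv : 0 < θv) {cΛ Lr Φ : ℝ}
    (hcΛ : 0 ≤ cΛ) (hLr : 0 ≤ Lr) (hΦ : 0 ≤ Φ) {β₀ : ℝ} (hβ₀ : 0 ≤ β₀) (n : ℕ) (hn : 0 < n)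
    (hr : ellStar C₄ O₁ F.L (O₁.d + 3) 3 2 2 (ApFlat O₁.γ₀ O₁.A₁ O₁.M Lr O₁.d) Φ ≤ (F.L : ℝ) ^ S)
    (hv : ellVolS82L C₄ 1 1 4 cΛ 1 F.L θv ((1 + β₀) * F.L ^ 1) (jvol82 1 ((1 + β₀) * F.L ^ 1)) ≤ (F.L : ℝ) ^ S) :
    Nonempty (CountRoadWitnessT3bWTVSL (toyData F G) C₄ O₁ θv 1 1 n hn (gW F.L S) ([] : List (ULoop F)) (HIndex.Idx Isk)
      (ℕ × Lab 1) (Lab 1)) :=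
  nonempty_countRoadWitnessT3bWTVSL_of_histReadingLWL82 (histReadDataLWL_toyData F G hS hθv hcΛ hLr hΦ hβ₀ n hn)
    (inInterval_toyData_gW F G hr) (inInterval_toyData_gW F G hv)

/-- **… AND UNCONDITIONALLY** on some window run. [decided toy] -/
theorem exists_countRoadWitnessT3bWTVSL_toyData_viaLWL82 {θv : ℝ} (hθv : 0 < θv) {cΛ Lr Φ : ℝ} (hcΛ : 0 ≤ cΛ)
    (hLr : 0 ≤ Lr) (hΦ : 0 ≤ Φ) {β₀ : ℝ} (hβ₀ : 0 ≤ β₀) (n : ℕ) (hn : 0 < n) :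
    ∃ S : ℕ, Nonempty (CountRoadWitnessT3bWTVSL (toyData F G) C₄ O₁ θv 1 1 n hn (gW F.L S) ([] : List (ULoop F))
      (HIndex.Idx Isk) (ℕ × Lab 1) (Lab 1)) := by
  obtain ⟨S, hS, hr, hv⟩ := exists_pow_windows F
    (ellStar C₄ O₁ F.L (O₁.d + 3) 3 2 2 (ApFlat O₁.γ₀ O₁.A₁ O₁.M Lr O₁.d) Φ)
    (ellVolS82L C₄ 1 1 4 cΛ 1 F.L θv ((1 + β₀) * F.L ^ 1) (jvol82 1 ((1 + β₀) * F.L ^ 1)))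
  exact ⟨S, nonempty_countRoadWitnessT3bWTVSL_toyData_viaLWL82 F G hS hθv hcΛ hLr hΦ hβ₀ n hn hr hv⟩

/-- HONESTY CERTIFICATE: (B) FAILS on the toy datum, so (b) §3's terminal theorem `continuumYM4Torus_of_histReadingLWL_fsc`
(binder `hB`) has no instance on it. [decided toy] -/
example : ¬ B16.EndStatementBPrinted (toyData F G).C := not_endStatementBPrinted_toy F G

end ToyData

end

end Summit.QuantumFields.BalabanUV.T4Continuum.HistoryRealiseCellsRunAssemblyWTVSSanity
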